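import Mathlib
import HarnessLib
import Summits.ValiantsHypothesis.ValiantsHypothesis.Theses.MonotoneRestoration
import Literature.Computability.AlgebraicComplexity.ArithCircuit
import Literature.Computability.AlgebraicComplexity.ArithCircuitProofs
import Literature.Computability.AlgebraicComplexity.MonotoneStructure
import Literature.Computability.AlgebraicComplexity.PermanentIrreducible
import Literature.ModelTheory.FiniteModelTheory.CkEquiv
import Summits.ValiantsHypothesis.ValiantsHypothesis.Theorems.MonotoneRestorationMonotoneRestorationQPCosetCount
import Summits.ValiantsHypothesis.ValiantsHypothesis.Theorems.MonotoneRestorationMonotoneRestorationQPSymmetricLB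
import Summits.ValiantsHypothesis.ValiantsHypothesis.Theorems.MonotoneRestorationMonotoneRestorationQPSupportSymmetrisation
import Summits.ValiantsHypothesis.ValiantsHypothesis.Theorems.MonotoneRestorationMonotoneRestorationQPSparseRegime
import Summits.ValiantsHypothesis.ValiantsHypothesis.Theorems.MonotoneRestorationMonotoneRestorationQPBeta
import Literature.Computability.AlgebraicComplexity.SymmetricArithCircuit
import Literature.Computability.AlgebraicComplexity.DawarWilsenach2025Proofs
import Literature.GroupTheory.PermutationGroups.SmallIndexSubgroups
import Summits.ValiantsHypothesis.ValiantsHypothesis.Theorems.MonotoneRestorationQP.Negative.LoadBearing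
import Summits.ValiantsHypothesis.ValiantsHypothesis.Theorems.MonotoneRestorationMonotoneRestorationQPPermSupportCount
import Literature.Computability.AlgebraicComplexity.IMMInVPProofs

/-! TTRL-lite variant V19257 of stmt-ValiantsHypothesis-15886

Target `stub_esymmRowSums_complexity`, move `lemma_proposal` (`[composition]`): the substitution
bound `L(f(g_1, …, g_m)) ≤ L(f) + Σ_i L(g_i)` (Bürgisser 2000, Rem. 2.7) for the tree's fan-in-two
measure `complexity`, in the `MvPolynomial.bind₁` spelling. The tree already proves it in the
`MvPolynomial.aeval` spelling (`Literature.Computability.AlgebraicComplexity.complexity_aeval_le`,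
`IMMInVPProofs.lean`: juxtapose minimal circuits for the `g_i` and plug their outputs into the
inputs of a minimal circuit for `f`); `aeval g = bind₁ g` is `MvPolynomial.aeval_eq_bind₁`. -/

-- `Summit.ValiantsHypothesis.ValiantsHypothesis.…` is the tree's mandated single-conjunct layout
-- (Sub = Summit), so the duplicated namespace component is intended.
set_option linter.dupNamespace false

namespace Summit.ValiantsHypothesis.ValiantsHypothesis.Theorems

open Summit.ValiantsHypothesis.ValiantsHypothesis.Theses.MonotoneRestoration
open Literature.Computability.AlgebraicComplexity

/-- **TTRL-lite variant V19257 of `stub_esymmRowSums_complexity`** (the sharing device,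
Bürgisser 2000, Rem. 2.7): over `ℝ≥0` (monotone circuits), for a finite variable set `σ`,
substituting polynomials `g i` (`i : σ`) into `f` costs at most `L(f) + Σ_i L(g i)` gates in the
fan-in-two measure `complexity`: `L(bind₁ g f) ≤ L(f) + Σ_i L(g i)`. This is
`complexity_aeval_le` read through `MvPolynomial.aeval_eq_bind₁`.
[cite: Burgisser2000, Rem. 2.7] -/
theorem stub_esymmRowSums_complexity_var19257 :
    ∀ (σ τ : Type) [Fintype σ] (f : MvPolynomial σ NNReal) (g : σ → MvPolynomial τ NNReal),
      complexity (MvPolynomial.bind₁ g f) ≤ complexity f + ∑ i, complexity (g i) := by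
  intro σ τ _ f g
  rw [← MvPolynomial.aeval_eq_bind₁]
  exact complexity_aeval_le f g

end Summit.ValiantsHypothesis.ValiantsHypothesis.Theorems
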